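import Summits.MatrixMultiplication.MatrixMultiplication.Theses.LevelGradedCohnUmans
import Literature.RepresentationTheory.FiniteGroups.IrreducibleCharacters

/-!
# `GradedPricing` (crux `stmt-MatrixMultiplication-7611`, route `LevelGradedCohnUmans`):
# load-bearing hypotheses and tightness (negative-side support)

Support file of the crux disprover (cdisprove seat).  The crux says: for a finite group `G`, a
BI-INVARIANT test space `J ≤ ℂ^G` and a `J`-SEPARATED triple `X, Y, Z ⊆ G`,
`(|X||Y||Z|)^(ω/3) ≤ Σᶠ_{χ ∈ Irr(G) ∩ J} χ(1)^ω`.  Proved here, `sorry`-free, each with a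
two-element-group witness (`Multiplicative (ZMod 2)`):

* `gradedPricing_false_without_biInv` — with bi-invariance of `J` dropped the statement is false
  (`J = ℂ·δ_g`, `g ≠ 1`, separates `({1},{1},{g})`: volume `1`, graded budget `0`);
* `gradedPricing_false_without_ones` — with the "`f = 1` on the pattern" half of separation
  dropped it is false (`J = ⊥`, `f = 0`);
* `gradedPricing_false_without_zeros` — with the "`f = 0` off the pattern" half dropped it is
  false (`J` = constants, `f = 1`, `X = G`: volume `2^(ω/3) > 1` = budget);
* `gradedPricing_attained` — the inequality is an EQUALITY at (`Z/2`, constants, `{1},{1},{1}`),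
  so `not_gradedPricing_strict`: the strict form is false and the constant `1` is optimal.

Helper facts of independent use: `apply_one_ne_zero` (an irreducible character does not vanish
at `1`), `irrChar_eq_one_of_forall_eq` (a constant irreducible character is trivial),
`irrChars_inter_span_one` (`Irr(G) ∩ constants = {1}`), `irrChars_inter_span_single`,
`irrChars_inter_bot`.
-/

noncomputable section

set_option linter.dupNamespace false

open scoped BigOperators
open Literature.RepresentationTheory.FiniteGroups Literature.Computability.AlgebraicComplexity

namespace Summit.MatrixMultiplication.MatrixMultiplication.Theorems.GradedPricing.Negative

/-! ## Helper facts on irreducible characters -/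

section Helpers

variable {G : Type} [Group G]

/-- An irreducible character does not vanish at `1` (an irreducible representation is non-zero).
[folklore] -/
theorem apply_one_ne_zero {χ : G → ℂ} (h : IsIrrChar G χ) : χ 1 ≠ 0 := by
  obtain ⟨V, _, _, _, ρ, hρ, rfl⟩ := h
  haveI := hρ
  haveI : Nontrivial V := by
    by_contra hV
    rw [not_nontrivial_iff_subsingleton] at hV
    have hbt : (⊥ : Subrepresentation ρ) = ⊤ :=
      Subrepresentation.toSubmodule_injective (Subsingleton.elim _ _)
    exact (IsSimpleOrder.bot_ne_top (α := Subrepresentation ρ)) hbt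
  rw [Representation.char_one]
  exact Nat.cast_ne_zero.mpr Module.finrank_pos.ne'

/-- A constant irreducible character is the trivial character `1` (orthonormality:
`⟨χ, χ⟩ = χ(1)² = 1`). [folklore] -/
theorem irrChar_eq_one_of_forall_eq [Fintype G] {χ : G → ℂ} (h : IsIrrChar G χ)
    (hc : ∀ g, χ g = χ 1) : χ = 1 := by
  have h1 := h.classInner_eq h
  rw [if_pos rfl, classInner_apply] at h1
  have hsum : ∑ s : G, χ s * χ s⁻¹ = Fintype.card G * (χ 1 * χ 1) := by
    rw [Finset.sum_congr rfl (fun s _ => by rw [hc s, hc s⁻¹]), Finset.sum_const, Finset.card_univ,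
      nsmul_eq_mul]
  rw [hsum, ← mul_assoc, inv_mul_cancel₀ (Nat.cast_ne_zero.mpr Fintype.card_ne_zero), one_mul] at h1
  obtain ⟨d, -, hd⟩ := h.exists_apply_one
  rw [hd] at h1
  have hdd : d * d = 1 := by exact_mod_cast h1
  have hd1 : d = 1 := by
    rcases Nat.lt_or_ge d 2 with hlt | hge
    · interval_cases d <;> simp_all
    · nlinarith
  funext g
  rw [hc g, hd, hd1, Nat.cast_one, Pi.one_apply]

/-- The trivial character is the constant function `1`. [folklore] -/
theorem character_trivial_eq_one : (Representation.trivial ℂ G ℂ).character = 1 := by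
  funext g
  have h1 : Representation.trivial ℂ G ℂ g = LinearMap.id :=
    LinearMap.ext fun v => Representation.trivial_apply ℂ g v
  rw [Representation.character, h1, LinearMap.trace_id, Module.finrank_self]
  simp

/-- `1 ∈ Irr(G)`. [folklore] -/
theorem one_mem_irrChars : (1 : G → ℂ) ∈ irrChars G :=
  character_trivial_eq_one (G := G) ▸ character_trivial_mem_irrChars

/-- `Irr(G) ∩ (constants) = {1}`. [folklore] -/
theorem irrChars_inter_span_one [Fintype G] :
    irrChars G ∩ ((Submodule.span ℂ {(1 : G → ℂ)} : Submodule ℂ (G → ℂ)) : Set (G → ℂ)) = {1} := by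
  ext χ
  simp only [Set.mem_inter_iff, SetLike.mem_coe, Submodule.mem_span_singleton,
    Set.mem_singleton_iff]
  constructor
  · rintro ⟨hχ, c, rfl⟩
    exact irrChar_eq_one_of_forall_eq hχ (fun g => by simp)
  · rintro rfl
    exact ⟨one_mem_irrChars, 1, one_smul _ _⟩

/-- `Irr(G) ∩ ℂ·δ_g = ∅` for `g ≠ 1` (every `f ∈ ℂ·δ_g` vanishes at `1`). [folklore] -/
theorem irrChars_inter_span_single [DecidableEq G] {g : G} (hg : g ≠ 1) :
    irrChars G ∩ ((Submodule.span ℂ {(Pi.single g (1 : ℂ) : G → ℂ)} : Submodule ℂ (G → ℂ)) :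
      Set (G → ℂ)) = ∅ := by
  ext χ
  simp only [Set.mem_inter_iff, SetLike.mem_coe, Submodule.mem_span_singleton,
    Set.mem_empty_iff_false, iff_false, not_and]
  rintro hχ ⟨c, rfl⟩
  exact apply_one_ne_zero hχ (by simp [hg.symm])

/-- `Irr(G) ∩ ⊥ = ∅`. [folklore] -/
theorem irrChars_inter_bot :
    irrChars G ∩ ((⊥ : Submodule ℂ (G → ℂ)) : Set (G → ℂ)) = ∅ := by
  ext χ
  simp only [Set.mem_inter_iff, Submodule.bot_coe, Set.mem_singleton_iff,
    Set.mem_empty_iff_false, iff_false, not_and]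
  rintro hχ rfl
  exact apply_one_ne_zero hχ rfl

/-- The graded budget of the constants is `1`. [folklore] -/
theorem budget_span_one [Fintype G] :
    ∑ᶠ χ ∈ irrChars G ∩ ((Submodule.span ℂ {(1 : G → ℂ)} : Submodule ℂ (G → ℂ)) : Set (G → ℂ)),
      (χ 1).re ^ omega ℂ = 1 := by
  rw [irrChars_inter_span_one, finsum_mem_singleton]
  simp

/-- `ω/3 > 0`. [folklore] -/
theorem omega_div_three_pos : 0 < omega ℂ / 3 :=
  div_pos (zero_lt_two.trans_le (omega_two_le (K := ℂ))) three_pos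

end Helpers

/-! ## The witnesses: the two-element group -/

/-- The non-identity element of `Multiplicative (ZMod 2)` is not `1`. [folklore] -/
theorem ofAdd_one_ne_one : (Multiplicative.ofAdd (1 : ZMod 2) : Multiplicative (ZMod 2)) ≠ 1 := by
  decide

/-- **Bi-invariance is load-bearing**: `GradedPricing` with the bi-invariance hypothesis on `J`
dropped is FALSE.  Witness `G = Z/2`, `J = ℂ·δ_g` (`g ≠ 1`), `X = Y = {1}`, `Z = {g}`: every
quadruple is the pattern, `δ_g` separates, volume term `1`, but no irreducible character lies in
`ℂ·δ_g`, so the graded budget is `0`. [folklore] -/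
theorem gradedPricing_false_without_biInv :
    ¬ ∀ (G : Type) [Group G] [Fintype G] (J : Submodule ℂ (G → ℂ)), ∀ X Y Z : Finset G,
      (∀ x₀ ∈ X, ∀ z₀ ∈ Z, ∃ f ∈ J, ∀ x ∈ X, ∀ y ∈ Y, ∀ y' ∈ Y, ∀ z ∈ Z,
        (x = x₀ ∧ y = y' ∧ z = z₀ → f (x⁻¹ * y * y'⁻¹ * z) = 1) ∧
        (¬ (x = x₀ ∧ y = y' ∧ z = z₀) → f (x⁻¹ * y * y'⁻¹ * z) = 0)) →
      ((X.card * Y.card * Z.card : ℕ) : ℝ) ^ (omega ℂ / 3) ≤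
        ∑ᶠ χ ∈ irrChars G ∩ (J : Set (G → ℂ)), (χ 1).re ^ omega ℂ := by
  intro h
  have hle := h (Multiplicative (ZMod 2))
    (Submodule.span ℂ {(Pi.single (Multiplicative.ofAdd (1 : ZMod 2)) (1 : ℂ) : _ → ℂ)})
    {1} {1} {Multiplicative.ofAdd (1 : ZMod 2)} (by
      intro x₀ hx₀ z₀ hz₀
      refine ⟨Pi.single (Multiplicative.ofAdd (1 : ZMod 2)) 1, Submodule.subset_span rfl, ?_⟩
      intro x hx y hy y' hy' z hz
      simp only [Finset.mem_singleton] at hx hy hy' hz hx₀ hz₀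
      subst hx hy hy' hz hx₀ hz₀
      exact ⟨fun _ => by simp, fun hne => absurd ⟨rfl, rfl, rfl⟩ hne⟩)
  rw [irrChars_inter_span_single ofAdd_one_ne_one, finsum_mem_empty] at hle
  have key : (1 : ℝ) ≤ 0 := by simpa using hle
  linarith

/-- **"`f = 1` on the pattern" is load-bearing**: with that half of the separation pattern
dropped, `GradedPricing` is FALSE.  Witness `J = ⊥` (bi-invariant), `f = 0`, `X = Y = Z = {1}`:
volume term `1 > 0` = budget. [folklore] -/
theorem gradedPricing_false_without_ones :
    ¬ ∀ (G : Type) [Group G] [Fintype G] (J : Submodule ℂ (G → ℂ)),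
      (∀ f ∈ J, ∀ a b : G, (fun g : G => f (a * g * b)) ∈ J) → ∀ X Y Z : Finset G,
      (∀ x₀ ∈ X, ∀ z₀ ∈ Z, ∃ f ∈ J, ∀ x ∈ X, ∀ y ∈ Y, ∀ y' ∈ Y, ∀ z ∈ Z,
        (¬ (x = x₀ ∧ y = y' ∧ z = z₀) → f (x⁻¹ * y * y'⁻¹ * z) = 0)) →
      ((X.card * Y.card * Z.card : ℕ) : ℝ) ^ (omega ℂ / 3) ≤
        ∑ᶠ χ ∈ irrChars G ∩ (J : Set (G → ℂ)), (χ 1).re ^ omega ℂ := by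
  intro h
  have hle := h (Multiplicative (ZMod 2)) ⊥
    (by intro f hf a b; rw [Submodule.mem_bot] at hf ⊢; subst hf; rfl) {1} {1} {1}
    (fun x₀ _ z₀ _ => ⟨0, Submodule.zero_mem _, fun x _ y _ y' _ z _ _ => rfl⟩)
  rw [irrChars_inter_bot, finsum_mem_empty] at hle
  have key : (1 : ℝ) ≤ 0 := by simpa using hle
  linarith

/-- **"`f = 0` off the pattern" is load-bearing** (this half carries the TPP): with it dropped,
`GradedPricing` is FALSE.  Witness `G = Z/2`, `J` = constants (bi-invariant, budget `1`), `f = 1`,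
`X = G`, `Y = Z = {1}`: volume term `2^(ω/3) > 1`. [folklore] -/
theorem gradedPricing_false_without_zeros :
    ¬ ∀ (G : Type) [Group G] [Fintype G] (J : Submodule ℂ (G → ℂ)),
      (∀ f ∈ J, ∀ a b : G, (fun g : G => f (a * g * b)) ∈ J) → ∀ X Y Z : Finset G,
      (∀ x₀ ∈ X, ∀ z₀ ∈ Z, ∃ f ∈ J, ∀ x ∈ X, ∀ y ∈ Y, ∀ y' ∈ Y, ∀ z ∈ Z,
        (x = x₀ ∧ y = y' ∧ z = z₀ → f (x⁻¹ * y * y'⁻¹ * z) = 1)) →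
      ((X.card * Y.card * Z.card : ℕ) : ℝ) ^ (omega ℂ / 3) ≤
        ∑ᶠ χ ∈ irrChars G ∩ (J : Set (G → ℂ)), (χ 1).re ^ omega ℂ := by
  intro h
  have hbi : ∀ f ∈ Submodule.span ℂ {(1 : Multiplicative (ZMod 2) → ℂ)}, ∀ a b,
      (fun g => f (a * g * b)) ∈ Submodule.span ℂ {(1 : Multiplicative (ZMod 2) → ℂ)} := by
    intro f hf a b
    obtain ⟨c, rfl⟩ := Submodule.mem_span_singleton.mp hf
    exact Submodule.mem_span_singleton.mpr ⟨c, by funext g; simp⟩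
  have hle := h (Multiplicative (ZMod 2)) _ hbi Finset.univ {1} {1}
    (fun x₀ _ z₀ _ => ⟨1, Submodule.subset_span rfl, fun x _ y _ y' _ z _ _ => rfl⟩)
  rw [budget_span_one] at hle
  have key : (2 : ℝ) ^ (omega ℂ / 3) ≤ 1 := by simpa using hle
  have h2 : (1 : ℝ) < (2 : ℝ) ^ (omega ℂ / 3) := Real.one_lt_rpow one_lt_two omega_div_three_pos
  linarith

/-- **The inequality of `GradedPricing` is attained**: at `G = Z/2`, `J` = constants,
`X = Y = Z = {1}` all hypotheses hold and both sides equal `1`. [folklore] -/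
theorem gradedPricing_attained :
    ∃ (G : Type) (_ : Group G) (_ : Fintype G) (J : Submodule ℂ (G → ℂ)) (X Y Z : Finset G),
      (∀ f ∈ J, ∀ a b : G, (fun g : G => f (a * g * b)) ∈ J) ∧
      (∀ x₀ ∈ X, ∀ z₀ ∈ Z, ∃ f ∈ J, ∀ x ∈ X, ∀ y ∈ Y, ∀ y' ∈ Y, ∀ z ∈ Z,
        (x = x₀ ∧ y = y' ∧ z = z₀ → f (x⁻¹ * y * y'⁻¹ * z) = 1) ∧
        (¬ (x = x₀ ∧ y = y' ∧ z = z₀) → f (x⁻¹ * y * y'⁻¹ * z) = 0)) ∧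
      ((X.card * Y.card * Z.card : ℕ) : ℝ) ^ (omega ℂ / 3) =
        ∑ᶠ χ ∈ irrChars G ∩ (J : Set (G → ℂ)), (χ 1).re ^ omega ℂ := by
  refine ⟨Multiplicative (ZMod 2), inferInstance, inferInstance, Submodule.span ℂ {1},
    {1}, {1}, {1}, ?_, ?_, ?_⟩
  · intro f hf a b
    obtain ⟨c, rfl⟩ := Submodule.mem_span_singleton.mp hf
    exact Submodule.mem_span_singleton.mpr ⟨c, by funext g; simp⟩
  · intro x₀ hx₀ z₀ hz₀
    refine ⟨1, Submodule.subset_span rfl, ?_⟩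
    intro x hx y hy y' hy' z hz
    simp only [Finset.mem_singleton] at hx hy hy' hz hx₀ hz₀
    subst hx hy hy' hz hx₀ hz₀
    exact ⟨fun _ => rfl, fun hne => absurd ⟨rfl, rfl, rfl⟩ hne⟩
  · rw [budget_span_one]
    simp

/-- **The strict form of `GradedPricing` is false** (by `gradedPricing_attained`). [folklore] -/
theorem not_gradedPricing_strict :
    ¬ ∀ (G : Type) [Group G] [Fintype G] (J : Submodule ℂ (G → ℂ)),
      (∀ f ∈ J, ∀ a b : G, (fun g : G => f (a * g * b)) ∈ J) → ∀ X Y Z : Finset G,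
      (∀ x₀ ∈ X, ∀ z₀ ∈ Z, ∃ f ∈ J, ∀ x ∈ X, ∀ y ∈ Y, ∀ y' ∈ Y, ∀ z ∈ Z,
        (x = x₀ ∧ y = y' ∧ z = z₀ → f (x⁻¹ * y * y'⁻¹ * z) = 1) ∧
        (¬ (x = x₀ ∧ y = y' ∧ z = z₀) → f (x⁻¹ * y * y'⁻¹ * z) = 0)) →
      ((X.card * Y.card * Z.card : ℕ) : ℝ) ^ (omega ℂ / 3) <
        ∑ᶠ χ ∈ irrChars G ∩ (J : Set (G → ℂ)), (χ 1).re ^ omega ℂ := by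
  intro h
  obtain ⟨G, _, _, J, X, Y, Z, hbi, hsep, heq⟩ := gradedPricing_attained
  exact (h G J hbi X Y Z hsep).ne heq

end Summit.MatrixMultiplication.MatrixMultiplication.Theorems.GradedPricing.Negative

end
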